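import Summits.QuantumAdvantage.QuantumAdvantage.Theorems.CharDialJLinSliceA

/-! # CharDialJLinSliceB — part 2/3 (mechanical split for landing of `CharDialJLinSlice`; content verbatim; scopes re-opened with their variables) -/

set_option linter.dupNamespace false
noncomputable section

namespace Summit.QuantumAdvantage.AdviceFreeQNC0.JLinPeel
open Finset Summit.QuantumAdvantage.AdviceFreeQNC0 JLinData
variable {p : ℕ} {n : ℕ}

section Absorb

/-- CharDialJLinSlice helper `form_absorb_ne` (decomp-qadv land package; see the module docstring). -/
theorem form_absorb_ne (D : JLinData p n) {g g₀ : Fin (n + 1)} (hg : g ≠ g₀) (i : Fin n) (u : Fin n → Bool) :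
    (absorb D g₀ i).form g u = D.form g u := by
  unfold JLinData.form
  rw [absorb_a_ne D hg i]

/-- **absorption preserves the strategy.** -/
theorem absorb_strat (D : JLinData p n) (g₀ : Fin (n + 1)) (i : Fin n) : (absorb D g₀ i).strat = D.strat := by
  classical
  funext g u
  show (absorb D g₀ i).h g u ((absorb D g₀ i).form g u) = D.h g u (D.form g u)
  by_cases hg : g = g₀
  · subst hg
    rw [form_absorb_self]
    by_cases hb : g ∈ D.blindCuts
    · have h0 : (∑ j, if u j then baseForm D g j else 0) = (0 : ZMod p) := by simp [baseForm, hb]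
      rw [h0]
      simp only [absorb, if_true, hb]
      simp [((JLinData.mem_blindCuts _).1 hb) u (D.form g u) 0]
    · have h0 : (∑ j, if u j then baseForm D g j else 0) = D.form g u := by simp [baseForm, hb, JLinData.form]
      rw [h0]
      simp [absorb, hb]
  · rw [form_absorb_ne D hg, absorb_h_ne D hg]

/-- two coordinates suffice to make `b + eᵢ` nonzero. -/
theorem exists_add_single_ne_zero [Fact p.Prime] (b : Fin n → ZMod p) (hn : 2 ≤ n) :
    ∃ i : Fin n, b + Pi.single i (1 : ZMod p) ≠ 0 := by
  classical
  by_contra h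
  push Not at h
  have h0 := congr_fun (h ⟨0, by omega⟩) ⟨0, by omega⟩
  have h1 := congr_fun (h ⟨1, by omega⟩) ⟨0, by omega⟩
  simp [Fin.ext_iff] at h0 h1
  rw [h1] at h0
  exact absurd (by simp at h0 : (1 : ZMod p) = 0) one_ne_zero

/-- three coordinates suffice to put `b + eⱼ` off any given line `𝔽_p · x`. -/
theorem exists_add_single_not_par [Fact p.Prime] (b x : Fin n → ZMod p) (hn : 3 ≤ n) :
    ∃ j : Fin n, ∀ μ : ZMod p, b + Pi.single j (1 : ZMod p) ≠ fun i => μ * x i := by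
  classical
  by_contra h
  push Not at h
  obtain ⟨μ₀, h0⟩ := h ⟨0, by omega⟩
  obtain ⟨μ₁, h1⟩ := h ⟨1, by omega⟩
  obtain ⟨μ₂, h2⟩ := h ⟨2, by omega⟩
  have e00 := congr_fun h0 ⟨0, by omega⟩
  have e10 := congr_fun h1 ⟨0, by omega⟩
  have e02 := congr_fun h0 ⟨2, by omega⟩
  have e12 := congr_fun h1 ⟨2, by omega⟩
  have e22 := congr_fun h2 ⟨2, by omega⟩
  simp [Fin.ext_iff] at e00 e10 e02 e12 e22
  -- e00 : b 0 + 1 = μ₀ * x 0, e10 : b 0 = μ₁ * x 0, e02 : b 2 = μ₀ * x 2, e12 : b 2 = μ₁ * x 2, e22 : b 2 + 1 = μ₂ * x 2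
  have hx2 : (μ₀ - μ₁) * x ⟨2, by omega⟩ = 0 := by rw [sub_mul, ← e02, ← e12, sub_self]
  rcases mul_eq_zero.1 hx2 with hμ | hx
  · have hμ' : μ₀ = μ₁ := sub_eq_zero.1 hμ
    rw [hμ', ← e10] at e00
    exact one_ne_zero ((add_eq_left).1 e00)
  · rw [hx, mul_zero] at e02 e22
    rw [e02, zero_add] at e22
    exact one_ne_zero e22

/-- **Every strategy with one spare junta slot per cut has a NON-rank-one presentation** (`n ≥ 3`). -/
theorem exists_nonRankOne_presentation [Fact p.Prime] (D : JLinData p n) (hJ : ∀ g, (D.J g).card + 1 ≤ Nat.log 2 n)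
    (hn : 3 ≤ n) :
    ∃ D' : JLinData p n, D'.strat = D.strat ∧ (∀ g, (D'.J g).card ≤ Nat.log 2 n) ∧
      ¬ (∃ a : Fin n → ZMod p, ∀ g, g ∉ D'.blindCuts → ∃ l : ZMod p, D'.a g = fun i => l * a i) := by
  classical
  set g0 : Fin (n + 1) := ⟨0, by omega⟩ with hg0
  set g1 : Fin (n + 1) := ⟨1, by omega⟩ with hg1
  have h01 : g0 ≠ g1 := by simp [hg0, hg1, Fin.ext_iff]
  obtain ⟨i₀, hx0⟩ := exists_add_single_ne_zero (baseForm D g0) (by omega)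
  set D₁ := absorb D g0 i₀ with hD₁
  obtain ⟨i₁, hy⟩ := exists_add_single_not_par (baseForm D₁ g1) (baseForm D g0 + Pi.single i₀ (1 : ZMod p)) hn
  set D₂ := absorb D₁ g1 i₁ with hD₂
  refine ⟨D₂, ?_, ?_, ?_⟩
  · rw [hD₂, absorb_strat, hD₁, absorb_strat]
  · intro g
    by_cases hg : g = g1
    · subst hg
      rw [hD₂, absorb_J_self, hD₁, absorb_J_ne D h01.symm]
      exact (card_union_le _ _).trans (by simpa using hJ g1)
    · rw [hD₂, absorb_J_ne D₁ hg]
      by_cases hg' : g = g0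
      · subst hg'
        rw [hD₁, absorb_J_self]
        exact (card_union_le _ _).trans (by simpa using hJ g0)
      · rw [hD₁, absorb_J_ne D hg']
        have := hJ g; omega
  · rintro ⟨a, ha⟩
    have hnb0 : g0 ∉ D₂.blindCuts := by
      rw [hD₂, absorb_blind_ne D₁ h01]
      exact absorb_not_blind D g0 i₀
    have hnb1 : g1 ∉ D₂.blindCuts := absorb_not_blind D₁ g1 i₁
    obtain ⟨l₀, hl₀⟩ := ha g0 hnb0
    obtain ⟨l₁, hl₁⟩ := ha g1 hnb1
    have ha0 : D₂.a g0 = baseForm D g0 + Pi.single i₀ (1 : ZMod p) := by rw [hD₂, absorb_a_ne D₁ h01, hD₁, absorb_a_self]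
    have ha1 : D₂.a g1 = baseForm D₁ g1 + Pi.single i₁ (1 : ZMod p) := by rw [hD₂, absorb_a_self]
    rw [ha0] at hl₀
    rw [ha1] at hl₁
    have hl0 : l₀ ≠ 0 := by
      rintro rfl
      apply hx0
      rw [hl₀]
      funext j
      simp
    apply hy (l₁ * l₀⁻¹)
    rw [hl₁]
    funext j
    rw [congr_fun hl₀ j]
    field_simp

/-- **AUDIT THEOREM 3 (junta absorption): hardness on the DATA-level complement (declared pencils of rank `≥ 2`) already
gives hardness of ALL data with junta budget one less** — the declared-rank dial is gameable on its large side. -/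
theorem pred_of_rankTwoPlus [Fact p.Prime] (h : (∃ θ : ℝ, θ < 1 ∧ ∃ n₀ : ℕ, ∀ n ≥ n₀, ∀ (c : ℕ) (D : JLinData p n),
      (∀ g, (D.J g).card ≤ Nat.log 2 n) → ¬ (∃ a : Fin n → ZMod p, ∀ g, g ∉ D.blindCuts → ∃ l : ZMod p, D.a g = fun i => l * a i) → (winCount c D.strat : ℝ) ≤ θ * (2 : ℝ) ^ n)) :
    (∃ θ : ℝ, θ < 1 ∧ ∃ n₀ : ℕ, ∀ n ≥ n₀, ∀ (c : ℕ) (D : JLinData p n),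
      (∀ g, (D.J g).card + 1 ≤ Nat.log 2 n) → (winCount c D.strat : ℝ) ≤ θ * (2 : ℝ) ^ n) := by
  obtain ⟨θ, hθ, n₀, hn₀⟩ := h
  refine ⟨θ, hθ, max n₀ 3, fun n hn c D hJ => ?_⟩
  obtain ⟨D', hstrat, hJ', hnr⟩ := exists_nonRankOne_presentation D hJ (le_trans (le_max_right _ _) hn)
  rw [← hstrat]
  exact hn₀ n (le_trans (le_max_left _ _) hn) c D' hJ' hnr

end Absorb

/-! ## §2′ The SEMANTIC slice split (rev 2): cut the complement as a class of STRATEGIES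

`D` is *semantically rank-one* if its strategy admits SOME rank-one presentation inside the junta budget; the complement
piece asks hardness only of data whose strategy admits none — invariant under every strategy-preserving re-presentation by
definition, so neither the cover (§1) nor the absorption (above) identifies it with the target. -/

/-- **The semantic slice split is EXACT**: data hardness ⟺ rank-one hardness ∧ hardness of data with NO rank-one presentation. -/
theorem data_iff_semSplit [Fact p.Prime] :
    (∃ θ : ℝ, θ < 1 ∧ ∃ n₀ : ℕ, ∀ n ≥ n₀, ∀ (c : ℕ) (D : JLinData p n),
      (∀ g, (D.J g).card ≤ Nat.log 2 n) → (winCount c D.strat : ℝ) ≤ θ * (2 : ℝ) ^ n) ↔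
    ((∃ θ : ℝ, θ < 1 ∧ ∃ n₀ : ℕ, ∀ n ≥ n₀, ∀ (c : ℕ) (D : JLinData p n),
      (∀ g, (D.J g).card ≤ Nat.log 2 n) → (∃ a : Fin n → ZMod p, ∀ g, g ∉ D.blindCuts → ∃ l : ZMod p, D.a g = fun i => l * a i) → (winCount c D.strat : ℝ) ≤ θ * (2 : ℝ) ^ n) ∧
     (∃ θ : ℝ, θ < 1 ∧ ∃ n₀ : ℕ, ∀ n ≥ n₀, ∀ (c : ℕ) (D : JLinData p n),
      (∀ g, (D.J g).card ≤ Nat.log 2 n) → ¬ (∃ D' : JLinData p n, D'.strat = D.strat ∧ (∀ g, (D'.J g).card ≤ Nat.log 2 n) ∧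
        ∃ a : Fin n → ZMod p, ∀ g, g ∉ D'.blindCuts → ∃ l : ZMod p, D'.a g = fun i => l * a i) → (winCount c D.strat : ℝ) ≤ θ * (2 : ℝ) ^ n)) := by
  constructor
  · rintro ⟨θ, hθ, n₀, hn₀⟩
    exact ⟨⟨θ, hθ, n₀, fun n hn c D hJ _ => hn₀ n hn c D hJ⟩, ⟨θ, hθ, n₀, fun n hn c D hJ _ => hn₀ n hn c D hJ⟩⟩
  · rintro ⟨⟨θ₁, hθ₁, n₁, hn₁⟩, ⟨θ₂, hθ₂, n₂, hn₂⟩⟩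
    refine ⟨max θ₁ θ₂, max_lt hθ₁ hθ₂, max n₁ n₂, fun n hn c D hJ => ?_⟩
    have h2n : (0 : ℝ) ≤ (2 : ℝ) ^ n := by positivity
    by_cases hs : (∃ D' : JLinData p n, D'.strat = D.strat ∧ (∀ g, (D'.J g).card ≤ Nat.log 2 n) ∧
        ∃ a : Fin n → ZMod p, ∀ g, g ∉ D'.blindCuts → ∃ l : ZMod p, D'.a g = fun i => l * a i)
    · obtain ⟨D', hstrat, hJ', hr⟩ := hs
      rw [← hstrat]
      exact (hn₁ n (le_trans (le_max_left _ _) hn) c D' hJ' hr).trans (mul_le_mul_of_nonneg_right (le_max_left _ _) h2n)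
    · exact (hn₂ n (le_trans (le_max_right _ _) hn) c D hJ hs).trans (mul_le_mul_of_nonneg_right (le_max_right _ _) h2n)

/-- the data-level complement hardness implies the semantic one (the smaller obligation). -/
theorem semTwoPlus_of_rankTwoPlus [Fact p.Prime] (h : (∃ θ : ℝ, θ < 1 ∧ ∃ n₀ : ℕ, ∀ n ≥ n₀, ∀ (c : ℕ) (D : JLinData p n),
      (∀ g, (D.J g).card ≤ Nat.log 2 n) → ¬ (∃ a : Fin n → ZMod p, ∀ g, g ∉ D.blindCuts → ∃ l : ZMod p, D.a g = fun i => l * a i) → (winCount c D.strat : ℝ) ≤ θ * (2 : ℝ) ^ n)) :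
    (∃ θ : ℝ, θ < 1 ∧ ∃ n₀ : ℕ, ∀ n ≥ n₀, ∀ (c : ℕ) (D : JLinData p n),
      (∀ g, (D.J g).card ≤ Nat.log 2 n) → ¬ (∃ D' : JLinData p n, D'.strat = D.strat ∧ (∀ g, (D'.J g).card ≤ Nat.log 2 n) ∧
        ∃ a : Fin n → ZMod p, ∀ g, g ∉ D'.blindCuts → ∃ l : ZMod p, D'.a g = fun i => l * a i) → (winCount c D.strat : ℝ) ≤ θ * (2 : ℝ) ^ n) := by
  obtain ⟨θ, hθ, n₀, hn₀⟩ := h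
  exact ⟨θ, hθ, n₀, fun n hn c D hJ hs => hn₀ n hn c D hJ fun hr => hs ⟨D, rfl, hJ, hr⟩⟩

/-- **CharDial's item 32604 ⟺ (rank-one hardness ∧ semantic-complement hardness at every prime `p ≥ 5`).** -/
theorem charDial_walkHardFJLinOdd_iff_semSplit :
    Summit.QuantumAdvantage.QuantumAdvantage.Theses.CharDial.WalkHardFJLinOdd ↔
      (∀ (p : ℕ) [Fact p.Prime], 5 ≤ p →
        (∃ θ : ℝ, θ < 1 ∧ ∃ n₀ : ℕ, ∀ n ≥ n₀, ∀ (c : ℕ) (D : JLinData p n),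
      (∀ g, (D.J g).card ≤ Nat.log 2 n) → (∃ a : Fin n → ZMod p, ∀ g, g ∉ D.blindCuts → ∃ l : ZMod p, D.a g = fun i => l * a i) → (winCount c D.strat : ℝ) ≤ θ * (2 : ℝ) ^ n)) ∧
      (∀ (p : ℕ) [Fact p.Prime], 5 ≤ p →
        (∃ θ : ℝ, θ < 1 ∧ ∃ n₀ : ℕ, ∀ n ≥ n₀, ∀ (c : ℕ) (D : JLinData p n),
      (∀ g, (D.J g).card ≤ Nat.log 2 n) → ¬ (∃ D' : JLinData p n, D'.strat = D.strat ∧ (∀ g, (D'.J g).card ≤ Nat.log 2 n) ∧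
        ∃ a : Fin n → ZMod p, ∀ g, g ∉ D'.blindCuts → ∃ l : ZMod p, D'.a g = fun i => l * a i) → (winCount c D.strat : ℝ) ≤ θ * (2 : ℝ) ^ n)) :=
  ⟨fun h => ⟨fun p _ hp => (data_iff_semSplit.1 (data_of_pres p (h p hp))).1,
      fun p _ hp => (data_iff_semSplit.1 (data_of_pres p (h p hp))).2⟩,
    fun h p _ hp => pres_of_data p (data_iff_semSplit.2 ⟨h.1 p hp, h.2 p hp⟩)⟩

/-- **CharDial's rung leaf from the two semantic slice pieces and the route's other items BY NAME.** -/
theorem charDial_closes_of_semSplit (hL : Summit.QuantumAdvantage.QuantumAdvantage.Theses.CharDial.FrobStructureLaw)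
    (h1 : ∀ (p : ℕ) [Fact p.Prime], 5 ≤ p →
        (∃ θ : ℝ, θ < 1 ∧ ∃ n₀ : ℕ, ∀ n ≥ n₀, ∀ (c : ℕ) (D : JLinData p n),
      (∀ g, (D.J g).card ≤ Nat.log 2 n) → (∃ a : Fin n → ZMod p, ∀ g, g ∉ D.blindCuts → ∃ l : ZMod p, D.a g = fun i => l * a i) → (winCount c D.strat : ℝ) ≤ θ * (2 : ℝ) ^ n))
    (h2 : ∀ (p : ℕ) [Fact p.Prime], 5 ≤ p →
        (∃ θ : ℝ, θ < 1 ∧ ∃ n₀ : ℕ, ∀ n ≥ n₀, ∀ (c : ℕ) (D : JLinData p n),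
      (∀ g, (D.J g).card ≤ Nat.log 2 n) → ¬ (∃ D' : JLinData p n, D'.strat = D.strat ∧ (∀ g, (D'.J g).card ≤ Nat.log 2 n) ∧
        ∃ a : Fin n → ZMod p, ∀ g, g ∉ D'.blindCuts → ∃ l : ZMod p, D'.a g = fun i => l * a i) → (winCount c D.strat : ℝ) ≤ θ * (2 : ℝ) ^ n))
    (hLift : Summit.QuantumAdvantage.QuantumAdvantage.Theses.CharDial.FrobLiftOdd)
    (hD : Summit.QuantumAdvantage.QuantumAdvantage.Theses.CharDial.DegLiftOdd) :
    Summit.QuantumAdvantage.AdviceFreeQNC0.AdviceFreeQNC0Odd :=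
  charDial_closes_of_core hL (fun p _ hp => core_of_pres p (charDial_walkHardFJLinOdd_iff_semSplit.2 ⟨h1, h2⟩ p hp)) hLift hD

/-! ## §3 The SLICING ENGINE: on a hyperplane slice every rank-one cut is a junta -/

/-- value of the linear form `a` at `u` (mod `p`). -/
def linVal (a : Fin n → ZMod p) (u : Fin n → Bool) : ZMod p := ∑ i, if u i then a i else 0

/-- CharDialJLinSlice helper `sum_card_slices` (decomp-qadv land package; see the module docstring). -/
theorem sum_card_slices [Fact p.Prime] (a : Fin n → ZMod p) :
    (∑ s : ZMod p, ((univ.filter fun u : Fin n → Bool => linVal a u = s).card : ℝ)) = (2 : ℝ) ^ n := by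
  rw [← Nat.cast_sum, ← card_eq_sum_card_fiberwise (f := fun u : Fin n → Bool => linVal a u) (s := univ) (t := univ)
    (fun _ _ => mem_univ _)]
  simp

/-- **Per-slice junta hardness ⟹ rank-one hardness** (PROVED: the sliced strategy `y^s g u = h g u (λ_g·s)` is a junta
strategy and agrees with `D.strat` on the slice `⟨a,u⟩ = s`; the `p` slices partition the cube, so slicing costs nothing in `θ`). -/
theorem rankOne_of_slice [Fact p.Prime] (h : (∃ θ : ℝ, θ < 1 ∧ ∃ n₀ : ℕ, ∀ n ≥ n₀, ∀ (c : ℕ) (a : Fin n → ZMod p) (s : ZMod p)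
      (y : Fin (n + 1) → (Fin n → Bool) → Bool),
      (∀ g, ∃ J : Finset (Fin n), J.card ≤ Nat.log 2 n ∧ ∀ u v : Fin n → Bool, (∀ i ∈ J, u i = v i) → y g u = y g v) →
        ((univ.filter fun u : Fin n → Bool => linVal a u = s ∧ ringWinU c y u = true).card : ℝ) ≤
          θ * ((univ.filter fun u : Fin n → Bool => linVal a u = s).card : ℝ))) :
    (∃ θ : ℝ, θ < 1 ∧ ∃ n₀ : ℕ, ∀ n ≥ n₀, ∀ (c : ℕ) (D : JLinData p n),
      (∀ g, (D.J g).card ≤ Nat.log 2 n) → (∃ a : Fin n → ZMod p, ∀ g, g ∉ D.blindCuts → ∃ l : ZMod p, D.a g = fun i => l * a i) → (winCount c D.strat : ℝ) ≤ θ * (2 : ℝ) ^ n) := by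
  classical
  obtain ⟨θ, hθ, n₀, hn₀⟩ := h
  refine ⟨θ, hθ, n₀, fun n hn c D hJ ⟨a, ha⟩ => ?_⟩
  -- the sliced (junta) strategies
  let ys : ZMod p → Fin (n + 1) → (Fin n → Bool) → Bool := fun s g u =>
    if hb : g ∈ D.blindCuts then D.h g u 0 else D.h g u (Classical.choose (ha g hb) * s)
  have hys : ∀ s g, ∃ J : Finset (Fin n), J.card ≤ Nat.log 2 n ∧
      ∀ u v : Fin n → Bool, (∀ i ∈ J, u i = v i) → ys s g u = ys s g v := fun s g =>
    ⟨D.J g, hJ g, fun u v huv => by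
      simp only [ys]
      split_ifs with hb
      · exact D.hJ g u v huv 0
      · exact D.hJ g u v huv _⟩
  have hstrat : ∀ s u, linVal a u = s → ∀ g, D.strat g u = ys s g u := by
    intro s u hu g
    simp only [ys, JLinData.strat]
    split_ifs with hb
    · exact (D.mem_blindCuts.1 hb) u _ _
    · have hag := Classical.choose_spec (ha g hb)
      have hag' : ∀ i, D.a g i = Classical.choose (ha g hb) * a i := fun i => congr_fun hag i
      have hform : D.form g u = Classical.choose (ha g hb) * s := by
        unfold JLinData.form
        rw [← hu]
        unfold linVal
        rw [mul_sum]
        refine sum_congr rfl fun i _ => ?_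
        rw [hag' i]
        split_ifs <;> simp
      rw [hform]
  have hcount : (winCount c D.strat : ℝ) =
      ∑ s : ZMod p, ((univ.filter fun u : Fin n → Bool => linVal a u = s ∧ ringWinU c (ys s) u = true).card : ℝ) := by
    unfold winCount
    rw [← Nat.cast_sum, card_eq_sum_card_fiberwise (f := fun u : Fin n → Bool => linVal a u) (t := univ)
      (fun _ _ => mem_univ _)]
    congr 1
    refine sum_congr rfl fun s _ => congrArg card ?_
    ext u
    simp only [mem_filter, mem_univ, true_and]
    constructor
    · rintro ⟨hw, hu⟩
      exact ⟨hu, by rwa [← UnreadTwist.ringWinU_congr (hstrat s u hu)]⟩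
    · rintro ⟨hu, hw⟩
      exact ⟨by rwa [UnreadTwist.ringWinU_congr (hstrat s u hu)], hu⟩
  rw [hcount]
  calc (∑ s : ZMod p, ((univ.filter fun u : Fin n → Bool => linVal a u = s ∧ ringWinU c (ys s) u = true).card : ℝ))
      ≤ ∑ s : ZMod p, θ * ((univ.filter fun u : Fin n → Bool => linVal a u = s).card : ℝ) :=
        sum_le_sum fun s _ => hn₀ n hn c a s (ys s) (hys s)
    _ = θ * (2 : ℝ) ^ n := by rw [← mul_sum, sum_card_slices]

/-! ## §4 W-CERTIFICATES: the proved sub-rungs BY NAME -/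

/-- **Line S in direction `a = 0` is the junta rung** (tree `walkHardFJuntaCuts`, `p ≠ 3`): PROVED. -/
theorem slice_dirZero [Fact p.Prime] (hp3 : p ≠ 3) :
    ∃ θ : ℝ, θ < 1 ∧ ∃ n₀ : ℕ, ∀ n ≥ n₀, ∀ (c : ℕ) (s : ZMod p) (y : Fin (n + 1) → (Fin n → Bool) → Bool),
      (∀ g, ∃ J : Finset (Fin n), J.card ≤ Nat.log 2 n ∧ ∀ u v : Fin n → Bool, (∀ i ∈ J, u i = v i) → y g u = y g v) →
        ((univ.filter fun u : Fin n → Bool => linVal (0 : Fin n → ZMod p) u = s ∧ ringWinU c y u = true).card : ℝ) ≤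
          θ * ((univ.filter fun u : Fin n → Bool => linVal (0 : Fin n → ZMod p) u = s).card : ℝ) := by
  classical
  obtain ⟨θ, hθ, H⟩ := walkHardFJuntaCuts p hp3
  obtain ⟨n₀, hn₀⟩ := H 1
  refine ⟨θ, hθ, n₀, fun n hn c s y hy => ?_⟩
  have h0 : ∀ u : Fin n → Bool, linVal (0 : Fin n → ZMod p) u = 0 := fun u => by
    unfold linVal; simp
  by_cases hs : s = 0
  · subst hs
    have hwin := hn₀ n hn c y fun g => by
      obtain ⟨J, hJ, hdep⟩ := hy g
      exact ⟨J, by rw [pow_one]; exact hJ, hdep⟩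
    have e1 : (univ.filter fun u : Fin n → Bool => linVal (0 : Fin n → ZMod p) u = 0 ∧ ringWinU c y u = true) =
        univ.filter fun u : Fin n → Bool => ringWinU c y u = true := by
      ext u; simp [h0 u]
    have e2 : (univ.filter fun u : Fin n → Bool => linVal (0 : Fin n → ZMod p) u = 0) = univ := by
      ext u; simp [h0 u]
    rw [e1, e2, card_univ, Fintype.card_fun, Fintype.card_bool, Fintype.card_fin]
    push_cast
    exact hwin
  · have e1 : (univ.filter fun u : Fin n → Bool => linVal (0 : Fin n → ZMod p) u = s ∧ ringWinU c y u = true) = ∅ := by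
      refine eq_empty_of_forall_notMem fun u hu => ?_
      rw [mem_filter] at hu
      exact hs (hu.2.1.symm.trans (h0 u))
    have e2 : (univ.filter fun u : Fin n → Bool => linVal (0 : Fin n → ZMod p) u = s) = ∅ := by
      refine eq_empty_of_forall_notMem fun u hu => ?_
      rw [mem_filter] at hu
      exact hs (hu.2.symm.trans (h0 u))
    rw [e1, e2]
    simp

/-- **Rank-one hardness on ALL-BLIND data is the junta rung**: PROVED (`p ≠ 3`). -/
theorem rankOne_allBlind [Fact p.Prime] (hp3 : p ≠ 3) :
    ∃ θ : ℝ, θ < 1 ∧ ∃ n₀ : ℕ, ∀ n ≥ n₀, ∀ (c : ℕ) (D : JLinData p n),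
      (∀ g, (D.J g).card ≤ Nat.log 2 n) → D.blindCuts = univ → (winCount c D.strat : ℝ) ≤ θ * (2 : ℝ) ^ n := by
  obtain ⟨θ, hθ, H⟩ := walkHardFJuntaCuts p hp3
  obtain ⟨n₀, hn₀⟩ := H 1
  refine ⟨θ, hθ, n₀, fun n hn c D hJ hb => hn₀ n hn c D.strat fun g => ⟨D.J g, by rw [pow_one]; exact hJ g, ?_⟩⟩
  intro u v huv
  show D.h g u (D.form g u) = D.h g v (D.form g v)
  rw [(D.mem_blindCuts.1 (hb ▸ mem_univ g)) u (D.form g u) (D.form g v)]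
  exact D.hJ g u v huv _


end Summit.QuantumAdvantage.AdviceFreeQNC0.JLinPeel
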